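import Summits.CriticalPhenomena.PercolationContinuityZ3.Theorems.PercNearOneGluingNoHeavyLowerTailMajorityGluingQCertEightFive135
import HarnessLib

/-!
# The `(8,5)` certificate with constant `27/20`: quadratic check, part 12 (lane prim-rate, constants-miner 1, gen 35; CANDIDATES §GEN-35)

Support file for the closed crux `NoHeavyLowerTail` (stmt-CriticalPhenomena-4575), majority-gluing line.  Chunks of `eightFive135.checkQ` by `decide +kernel` (`maxHeartbeats 0` scoped to the closed evaluations).  No sorries.
-/

namespace Summit.CriticalPhenomena.PercolationContinuityZ3.Theorems

namespace HubOnly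
namespace QCert

set_option maxHeartbeats 0 in
/-- The quadratic check passes on the variable rows `[132, 135)`. -/
theorem eightFive135_checkQ_132 : eightFive135.checkQ 132 135 = true := by decide +kernel

set_option maxHeartbeats 0 in
/-- The quadratic check passes on the variable rows `[135, 138)`. -/
theorem eightFive135_checkQ_135 : eightFive135.checkQ 135 138 = true := by decide +kernel

set_option maxHeartbeats 0 in
/-- The quadratic check passes on the variable rows `[138, 141)`. -/
theorem eightFive135_checkQ_138 : eightFive135.checkQ 138 141 = true := by decide +kernel

set_option maxHeartbeats 0 in
/-- The quadratic check passes on the variable rows `[141, 144)`. -/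
theorem eightFive135_checkQ_141 : eightFive135.checkQ 141 144 = true := by decide +kernel


end QCert
end HubOnly

end Summit.CriticalPhenomena.PercolationContinuityZ3.Theorems
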